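import Summits.HodgeConjecture.HodgeConjecture.Theorems.F0P6aDatumOfInputsDefsDock   -- ★ previous part of the same Lines workfile `F0_P6a_DatumOfInputs` (Defs side; size-lint split ×4)
import HarnessLib

/-!
# `F0P6aDatumOfInputsDefsLetters` — ★ RE-HOME of the DEFS SIDE of `Lines/F0_P6a_DatumOfInputs.lean` (ED. 3 a42642215a80d44d), PART 2 of 4 = §0c–§0d letters `SpecReadings`, `IsogHomLaw`, `IsogKerLaw`, `QuotQuot₀Law`, `Quot₀RoofLaw`, `DownReadings`, packagers `blockOf`, `frobOf` (ED. 3 ll. 310–483; `section Letters` re-opened with its two `variable` blocks :184–193 and :227 replayed).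

See PART 1 `Theorems/F0P6aDatumOfInputsDefsDock.lean` for the full re-home header and the hub՚s ED. 3 docstring (verbatim there).  Namespace and sections KEPT; code bytes =
the workfile՚s, docstrings included; options preamble repeated from PART 1.
HONEST LABEL: HC_CM is proved only modulo the 7 printed citations (2 remaining named inputs hLiu418 = stmt-HodgeConjecture-24832, h413 = stmt-HodgeConjecture-24833) until rung 0 closes; a re-home is count-neutral.
-/

set_option autoImplicit false

noncomputable section

namespace Summit.HodgeConjecture.HodgeConjecture.Cruxes.HLiu418.F0P6aDatumOfInputs

set_option linter.dupNamespace false  -- `Summit.HodgeConjecture.HodgeConjecture.…` BY DESIGN (D-0017)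

open CategoryTheory CategoryTheory.Limits NumberField IsDedekindDomain MulAction
open scoped Matrix Polynomial Pointwise MonoidalCategory
open Literature.NumberTheory.GaloisRepresentations
open Literature.NumberTheory.Automorphic Literature.NumberTheory.Automorphic.UnitaryGroup
open Literature.AlgebraicGeometry.ShimuraVarieties.UnitaryCanonicalModel
open Literature.NumberTheory.Automorphic.Liu2021.AppendixC
open Literature.AlgebraicGeometry.Motives (AlgPoints IntegralModel SchemeOver thickening thickeningGalAction thickeningLift specOver relFrobeniusOver frobeniusTwistOver)
open Literature.NumberTheory.DiophantineGeometry (geomResidueField specialFibreFunctor specResidueField)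
open Literature.AlgebraicGeometry.RelativeSpec (ActionOver)
open Literature.NumberTheory.EllipticCurves (genericFibre)
open Literature.AlgebraicGeometry.GroupSchemes.AffineGroupScheme (Alg quotIncl)
open Summit.HodgeConjecture.HodgeConjecture.Cruxes.HLiu418.F0P6cDictConstructors (kerFI AdmSub IdealIsEtale isAdm_kerFI)
open Summit.HodgeConjecture.HodgeConjecture.Cruxes.HLiu418.F0P6aModuliDatumDefs
open Summit.HodgeConjecture.HodgeConjecture.Cruxes.HLiu418.F0P6aRGDAssembly

section Letters

variable {F : Type} [Field F] [NumberField F] [IsCMField F] {ι₁ : F →+* ℂ}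
    {Jstar : Matrix (Fin 2) (Fin 2) F}
    {K₀ : C5.OpenCompactSubgroup ↥(finAdelic ↥(maximalRealSubfield F) F (IsCMField.complexConj F) 2 Jstar)}
    {S : RecordSystemGS F Jstar ι₁ K₀} {hU7ₛ : S.HeckeTranslateDefinedOver}
    {hJ : (Jstar.map (IsCMField.complexConj F))ᵀ = Jstar} {hJu : IsUnit Jstar}
    {Fi : Type} [Field Fi] [Algebra F Fi] {Kc : C5.SmallLevel K₀} {G : Type} [Group G]
    {𝓜 : IntegralModel (𝓞 F) F ((thickening F Fi).obj (S.M.obj Kc))}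
    {w : HeightOneSpectrum (𝓞 F)} {hw : (IsCMField.complexConj F) • w ≠ w} {h𝓨 : (𝓜.localise w).IsSmoothProper 1}
    {θ : ActionOver (𝓜.localise w).total.hom ((Fi ≃ₐ[F] Fi) × G)}
    {e : Fi →ₐ[F] AlgebraicClosure (w.adicCompletion F)}

variable (I : RGDInputsAt F ι₁ Jstar K₀ S hU7ₛ hJ hJu Fi Kc G 𝓜 w hw h𝓨 θ e) [ExpChar (geomResidueField w) I.pChar]

set_option genInjectivity false in
set_option maxHeartbeats 400000 in
/-- **`SpecReadings I 𝔡 quotΩ translΩ`** — THE DOWNSTAIRS READINGS OF THE DATUM, LIGHT ROWS (memo rows G8 ∕ G11 ∕ (b4′) of G10): the specialisation of lines `sp` (D5), the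
special quotient `quot` and the special ideal translation `transl` (D8, SP4 `quot := red₀ ∘ quotΩ ∘ lift`, well-defined by `inj₀`), the twist transport `smap` (D9, SP5), with
the laws (c2) `red_quotΩ`∕`red_translΩ`, (b4′) `canonicalLine₀`, `smap_kerF`∕`quot_smap` — field texts = the `ModuliDatum` ∕ `BlockReading₀` texts over the carriers BY
CONSTRUCTION (`Sub := SubOf I 𝔡`, `kerF := kerFOf I 𝔡`, `IsEtale := IsEtaleOf I 𝔡`, `Line := LineOf I`).  One interface because the DEFINITIONS of `sp`∕`quot`∕`smap` need the
schematic-closure vocabulary over `𝒪_Ω̄` (A-p03 (g30) organ (S-c); GEN heir (g31) Q4: D-line §0 at ED. 2).  A `Type`-valued record; NOTHING is asserted by declaring it.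
[cite: Liu2021, Prop. D.8 p. 135, pp. 136–138] [cite: Carayol1986Compositio, §10.3 Prop. p. 211] [cite: RapoportSmithlingZhang2020Diagonal, §3.4–§3.5, pp. 12–14] -/
structure SpecReadings (𝔡 : ∀ xbar, DockAt I xbar)
    (quotΩ : ∀ y, LineOf I y → AlgPoints (S.M.obj Kc) (AlgebraicClosure (w.adicCompletion F)))
    (translΩ : AlgPoints (S.M.obj Kc) (AlgebraicClosure (w.adicCompletion F)) → AlgPoints (S.M.obj Kc) (AlgebraicClosure (w.adicCompletion F))) where
  /-- D5: specialisation of a line, read at `red₀ y` (schematic closure over `𝒪_Ω̄`, then special fibre, through `hkerG₀`). [cite: Liu2021, p. 137] -/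
  sp : ∀ y, LineOf I y → SubOf I 𝔡 (red₀Of S Kc 𝓜 w h𝓨 e y)
  /-- D8: the special quotient of `x̄` by a member of `Sub x̄` (SP4). [cite: Liu2021, Prop. D.8 p. 135] -/
  quot : ∀ xbar, SubOf I 𝔡 xbar → AlgPoints (𝓜.localise w).reductionAt (geomResidueField w)
  /-- D8: the special ideal translation `⟨ϖ⟩` (SP4). [cite: Liu2021, Prop. D.8 p. 135] -/
  transl : AlgPoints (𝓜.localise w).reductionAt (geomResidueField w) → AlgPoints (𝓜.localise w).reductionAt (geomResidueField w)
  /-- (c2): `red₀` commutes with the moduli quotient. [cite: Liu2021, p. 137] -/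
  red_quotΩ : ∀ y (L : LineOf I y), red₀Of S Kc 𝓜 w h𝓨 e (quotΩ y L) = quot (red₀Of S Kc 𝓜 w h𝓨 e y) (sp y L)
  /-- (c2): `red₀` commutes with the ideal translation. [cite: Liu2021, p. 137] -/
  red_translΩ : ∀ y, red₀Of S Kc 𝓜 w h𝓨 e (translΩ y) = transl (red₀Of S Kc 𝓜 w h𝓨 e y)
  /-- **(b4′) THE CANONICAL LINE** (★ (E-b4′) `CanonicalLine.existsUnique_admK_spI_eq_kerFI`). [cite: Liu2021, p. 137] [cite: Carayol1986Compositio, §10.3 Prop. p. 211] -/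
  canonicalLine₀ : ∀ y, (∃ H : SubOf I 𝔡 (red₀Of S Kc 𝓜 w h𝓨 e y), IsEtaleOf I 𝔡 H) →
    ∃ L₀ : LineOf I y, sp y L₀ = kerFOf I 𝔡 (red₀Of S Kc 𝓜 w h𝓨 e y) ∧ ∀ L : LineOf I y, sp y L = kerFOf I 𝔡 (red₀Of S Kc 𝓜 w h𝓨 e y) → L = L₀
  /-- D9 TWIST: transport of special subgroups along `θ(γ, 1)_s` (SP5). [cite: RapoportSmithlingZhang2020Diagonal, §3.4–§3.5, pp. 12–14] -/
  smap : ∀ (τ : Fi ≃ₐ[F] Fi) (xbar : AlgPoints (𝓜.localise w).reductionAt (geomResidueField w)), SubOf I 𝔡 xbar → SubOf I 𝔡 (actOf S Kc 𝓜 w θ τ xbar)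
  /-- D9 TWIST: the transport fixes the Frobenius kernel. [cite: SGA3I, VII_A 4.1] -/
  smap_kerF : ∀ τ xbar, smap τ xbar (kerFOf I 𝔡 xbar) = kerFOf I 𝔡 (actOf S Kc 𝓜 w θ τ xbar)
  /-- D9 TWIST: the special quotient is `θ`-equivariant. [cite: RapoportSmithlingZhang2020Diagonal, §3.4–§3.5, pp. 12–14] -/
  quot_smap : ∀ τ xbar (H : SubOf I 𝔡 xbar), quot (actOf S Kc 𝓜 w θ τ xbar) (smap τ xbar H) = actOf S Kc 𝓜 w θ τ (quot xbar H)

set_option maxHeartbeats 400000 in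
open scoped MonObj Obj in
/-- K-DATA law **`IsogHomLaw`** — the layer maps `isogW₀ x̄ H : G₀ x̄ → G₀ (quot x̄ H)` are homomorphisms (the `BlockReading₀.isogW₀_hom` text over the dock).  A definition.
[cite: Liu2021, p. 137] -/
def IsogHomLaw (𝔡 : ∀ xbar, DockAt I xbar) (quot : ∀ xbar, SubOf I 𝔡 xbar → AlgPoints (𝓜.localise w).reductionAt (geomResidueField w))
    (isogW₀ : ∀ xbar (H : SubOf I 𝔡 xbar), (𝔡 xbar).G₀ ⟶ (𝔡 (quot xbar H)).G₀) : Prop :=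
  ∀ xbar (H : SubOf I 𝔡 xbar), letI := (𝔡 xbar).grp₀; letI := (𝔡 (quot xbar H)).grp₀; IsMonHom (isogW₀ xbar H)

set_option maxHeartbeats 400000 in
set_option synthInstance.maxHeartbeats 100000 in
open scoped MonObj Obj in
/-- K-DATA law **`IsogKerLaw`** — the layer map `isogW₀ x̄ H` KILLS `H` (the `BlockReading₀.isogW₀_ker` text over the dock, `subEquiv = refl`).  A definition. [cite: Liu2021, p. 137] -/
def IsogKerLaw (𝔡 : ∀ xbar, DockAt I xbar) (quot : ∀ xbar, SubOf I 𝔡 xbar → AlgPoints (𝓜.localise w).reductionAt (geomResidueField w))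
    (isogW₀ : ∀ xbar (H : SubOf I 𝔡 xbar), (𝔡 xbar).G₀ ⟶ (𝔡 (quot xbar H)).G₀) : Prop :=
  ∀ xbar (H : SubOf I 𝔡 xbar), letI := (𝔡 xbar).grp₀; haveI := (𝔡 xbar).aff₀; letI := (𝔡 (quot xbar H)).grp₀;
    quotIncl (𝔡 xbar).G₀ H.1 ≫ isogW₀ xbar H = 1

set_option maxHeartbeats 400000 in
/-- **D6 IN KILLS-FORM `QuotQuot₀Law`** (the `BlockReading₀.quot_quot₀` text over the dock; ROAD H: ★ HBT upstairs + (H4′)(H5)).  A definition.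
[cite: Liu2021, Prop. D.8 (2) p. 135, p. 137] -/
def QuotQuot₀Law (𝔡 : ∀ xbar, DockAt I xbar) (quot : ∀ xbar, SubOf I 𝔡 xbar → AlgPoints (𝓜.localise w).reductionAt (geomResidueField w))
    (transl : AlgPoints (𝓜.localise w).reductionAt (geomResidueField w) → AlgPoints (𝓜.localise w).reductionAt (geomResidueField w))
    (isogW₀ : ∀ xbar (H : SubOf I 𝔡 xbar), (𝔡 xbar).G₀ ⟶ (𝔡 (quot xbar H)).G₀) : Prop :=
  ∀ xbar (H : SubOf I 𝔡 xbar) (H' : SubOf I 𝔡 (quot xbar H)),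
    (letI := (𝔡 (quot xbar H)).grp₀; haveI := (𝔡 (quot xbar H)).aff₀;
      H'.1 ≤ (RingHom.ker (isogW₀ xbar H).left.appTop.hom : Ideal (Alg (𝔡 (quot xbar H)).G₀))) →
      quot (quot xbar H) H' = transl xbar

set_option maxHeartbeats 400000 in
/-- **(R-2) `Quot₀RoofLaw` — THE DOWNSTAIRS ROOF OF THE CANONICAL TRANSLATE WITH THE FROBENIUS-KERNEL LAW** (the `FrobReading₀.quot₀_roof` text over the carriers, reading
`frobIdeal γ`): reduction of the generic roof along the integral points + the congruence relation (rL).  A definition.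
[cite: Liu2021, Prop. D.8 (3) p. 135, pp. 136–138] [cite: RapoportSmithlingZhang2020Diagonal, §4.3 (4.23) p. 21] -/
def Quot₀RoofLaw (𝔡 : ∀ xbar, DockAt I xbar) (quotΩ : ∀ y, LineOf I y → AlgPoints (S.M.obj Kc) (AlgebraicClosure (w.adicCompletion F)))
    (sp : ∀ y, LineOf I y → SubOf I 𝔡 (red₀Of S Kc 𝓜 w h𝓨 e y)) (frobIdeal : (Fi ≃ₐ[F] Fi) → Ideal (𝓞 F)) : Prop :=
  ∀ (σ : Field.absoluteGaloisGroup (w.adicCompletion F)), IsAbsArithFrob σ → ∀ γ : Fi ≃ₐ[F] Fi,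
    ((AlgEquiv.restrictScalars F (Field.absoluteGaloisGroup.toAlgEquiv (w.adicCompletion F) σ) :
        AlgebraicClosure (w.adicCompletion F) ≃ₐ[F] AlgebraicClosure (w.adicCompletion F)) :
        AlgebraicClosure (w.adicCompletion F) →ₐ[F] AlgebraicClosure (w.adicCompletion F)).comp e = e.comp (γ : Fi →ₐ[F] Fi) →
    ∀ y (L : LineOf I y), sp y L = kerFOf I 𝔡 (red₀Of S Kc 𝓜 w h𝓨 e y) →
      Roof₀ 𝓜 w I.univ I.act I.dual I.pol I.lvl I.pChar I.fDeg w.asIdeal (frobIdeal γ) (red₀Of S Kc 𝓜 w h𝓨 e y) (red₀Of S Kc 𝓜 w h𝓨 e (quotΩ y L))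

set_option genInjectivity false in
set_option maxHeartbeats 400000 in
/-- **`DownReadings I 𝔡 quotΩ translΩ`** — THE DOWNSTAIRS READINGS WITH THEIR LAWS, AS ONE INTERFACE (memo rows G8 ∕ G10 ∕ G11): the light rows
`SpecReadings` plus the `[ϖ]`-layer maps `isogW₀` of the special quotient isogenies (K-DATA) with `IsogHomLaw`, `IsogKerLaw` and D6 `QuotQuot₀Law` (each law a named `Prop`,
so that no declaration re-elaborates the dock tower twice — Defs :803 lesson); the Frobenius roof `Quot₀RoofLaw` reads the co-ideal `𝔠(γ)` and is OWNED BY `stub_FROB` (ED. 1 v2).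
ED. 2 of this file re-cuts `stub_DOWN` into `stub_SPEC`∕`stub_TWIST`∕`stub_LAYER`∕`stub_D6` along these names (memo §3).  A `Type`-valued record; NOTHING is asserted by declaring it.
[cite: Liu2021, Prop. D.8 p. 135, pp. 136–138] [cite: Tate1997FiniteFlatGroupSchemes, (3.7)] -/
structure DownReadings (𝔡 : ∀ xbar, DockAt I xbar)
    (quotΩ : ∀ y, LineOf I y → AlgPoints (S.M.obj Kc) (AlgebraicClosure (w.adicCompletion F)))
    (translΩ : AlgPoints (S.M.obj Kc) (AlgebraicClosure (w.adicCompletion F)) → AlgPoints (S.M.obj Kc) (AlgebraicClosure (w.adicCompletion F))) where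
  /-- the light rows. [cite: Liu2021, Prop. D.8 p. 135] -/
  spec : SpecReadings I 𝔡 quotΩ translΩ
  /-- K-DATA — the `[ϖ]`-layer map of the quotient isogeny `A_x̄ → A_{quot x̄ H}` on the `c•w`-layers. [cite: Liu2021, Prop. D.8 p. 135, p. 137] -/
  isogW₀ : ∀ xbar (H : SubOf I 𝔡 xbar), (𝔡 xbar).G₀ ⟶ (𝔡 (spec.quot xbar H)).G₀
  /-- a homomorphism. [cite: Liu2021, p. 137] -/
  isogW₀_hom : IsogHomLaw I 𝔡 spec.quot isogW₀
  /-- it KILLS `H`. [cite: Liu2021, p. 137] -/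
  isogW₀_ker : IsogKerLaw I 𝔡 spec.quot isogW₀
  /-- D6 in kills-form. [cite: Liu2021, Prop. D.8 (2) p. 135] -/
  quot_quot₀ : QuotQuot₀Law I 𝔡 spec.quot spec.transl isogW₀

/-! ### §0d THE PACKAGERS (sorry-free): `blockOf` ∕ `frobOf` assemble the two nested records of `ModuliDatum` from the dock and the readings, each in its own budget -/

set_option maxHeartbeats 400000 in
/-- **`blockOf I 𝔡 𝔯 : BlockReading₀ …` over the carriers BY CONSTRUCTION** — the 24 K-rows from the dock `𝔡` (G6; `sch₀Of` unfolds, `act₀Of` is definitionally the light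
action, `kerFI` is the light Frobenius-kernel ideal), `subEquiv := Equiv.refl`, `kerF_spec := rfl`, `isEtale_spec := Iff.rfl` (G5), the layer rows and (b4′) from `𝔯`.
Sorry-free. [cite: Tate1997FiniteFlatGroupSchemes, (3.7)] [cite: Liu2021, p. 137] -/
def blockOf (𝔡 : ∀ xbar, DockAt I xbar)
    {quotΩ : ∀ y, LineOf I y → AlgPoints (S.M.obj Kc) (AlgebraicClosure (w.adicCompletion F))}
    {translΩ : AlgPoints (S.M.obj Kc) (AlgebraicClosure (w.adicCompletion F)) → AlgPoints (S.M.obj Kc) (AlgebraicClosure (w.adicCompletion F))}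
    (𝔯 : DownReadings I 𝔡 quotΩ translΩ) :
    haveI : CharP (geomResidueField w) I.pChar := I.charP₀
    BlockReading₀ S Kc 𝓜 w h𝓨 e I.univ I.act I.pChar I.fDeg (LineOf I) (SubOf I 𝔡) (kerFOf I 𝔡) (fun {_} H => IsEtaleOf I 𝔡 H)
      𝔯.spec.quot 𝔯.spec.transl 𝔯.spec.sp := by
  haveI : CharP (geomResidueField w) I.pChar := I.charP₀
  exact
  { G₀ := fun xbar => (𝔡 xbar).G₀
    grp₀ := fun xbar => (𝔡 xbar).grp₀
    comm₀ := fun xbar => (𝔡 xbar).comm₀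
    aff₀ := fun xbar => (𝔡 xbar).aff₀
    fin₀ := fun xbar => (𝔡 xbar).fin₀
    β₀ := fun xbar => (𝔡 xbar).β₀
    hβ₀ := fun xbar => (𝔡 xbar).hβ₀
    ι₀G := fun xbar => (𝔡 xbar).ι₀G
    hι₀G := fun xbar => (𝔡 xbar).hι₀G
    hkerG₀ := fun xbar => (𝔡 xbar).hkerG₀
    hβ₀G := fun xbar => (𝔡 xbar).hβ₀G
    U₀ := fun xbar => (𝔡 xbar).U₀
    grpU₀ := fun xbar => (𝔡 xbar).grpU₀
    affU₀ := fun xbar => (𝔡 xbar).affU₀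
    jU₀ := fun xbar => (𝔡 xbar).jU₀
    hU₀ := fun xbar => (𝔡 xbar).hU₀
    NU₀ := fun xbar => (𝔡 xbar).NU₀
    θU₀ := fun xbar => (𝔡 xbar).θU₀
    hFFU₀ := fun xbar => (𝔡 xbar).hFFU₀
    hrkG₀ := fun xbar => (𝔡 xbar).hrkG₀
    hrkF₀ := fun xbar => (𝔡 xbar).hrkF₀
    hpts₀ := fun xbar => (𝔡 xbar).hpts₀
    hsimple₀ := fun xbar => (𝔡 xbar).hsimple₀
    subEquiv := fun _ => Equiv.refl _
    kerF_spec := fun _ => rfl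
    isEtale_spec := fun _ _ => Iff.rfl
    isogW₀ := 𝔯.isogW₀
    isogW₀_hom := 𝔯.isogW₀_hom
    isogW₀_ker := 𝔯.isogW₀_ker
    quot_quot₀ := 𝔯.quot_quot₀
    canonicalLine₀ := 𝔯.spec.canonicalLine₀ }

set_option maxHeartbeats 400000 in
/-- **`frobOf … : FrobReading₀ …` over the carriers BY CONSTRUCTION** — the five `FrobReading₀` rows from the letters of `stub_FROB` (twist data existential, read here as
parameters).  Sorry-free. [cite: Liu2021, Prop. D.8 (3) p. 135, pp. 136–138] [cite: Shimura1998, §13.1 Thm. 1 (pp. 97–99)] -/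
def frobOf (𝔡 : ∀ xbar, DockAt I xbar)
    {quotΩ : ∀ y, LineOf I y → AlgPoints (S.M.obj Kc) (AlgebraicClosure (w.adicCompletion F))}
    {translΩ : AlgPoints (S.M.obj Kc) (AlgebraicClosure (w.adicCompletion F)) → AlgPoints (S.M.obj Kc) (AlgebraicClosure (w.adicCompletion F))}
    (𝔯 : DownReadings I 𝔡 quotΩ translΩ)
    {twistIdeal : (Fi ≃ₐ[F] Fi) → Ideal (𝓞 F)} {twistNorm : (Fi ≃ₐ[F] Fi) → ℕ} {frobIdeal : (Fi ≃ₐ[F] Fi) → Ideal (𝓞 F)}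
    (hfrobIdeal : ∀ (σ : Field.absoluteGaloisGroup (w.adicCompletion F)), IsAbsArithFrob σ → ∀ γ : Fi ≃ₐ[F] Fi,
        ((AlgEquiv.restrictScalars F (Field.absoluteGaloisGroup.toAlgEquiv (w.adicCompletion F) σ) :
            AlgebraicClosure (w.adicCompletion F) ≃ₐ[F] AlgebraicClosure (w.adicCompletion F)) :
            AlgebraicClosure (w.adicCompletion F) →ₐ[F] AlgebraicClosure (w.adicCompletion F)).comp e = e.comp (γ : Fi →ₐ[F] Fi) →
        frobIdeal γ * w.asIdeal = twistIdeal γ)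
    (htwistNorm : ∀ (σ : Field.absoluteGaloisGroup (w.adicCompletion F)), IsAbsArithFrob σ → ∀ γ : Fi ≃ₐ[F] Fi,
        ((AlgEquiv.restrictScalars F (Field.absoluteGaloisGroup.toAlgEquiv (w.adicCompletion F) σ) :
            AlgebraicClosure (w.adicCompletion F) ≃ₐ[F] AlgebraicClosure (w.adicCompletion F)) :
            AlgebraicClosure (w.adicCompletion F) →ₐ[F] AlgebraicClosure (w.adicCompletion F)).comp e = e.comp (γ : Fi →ₐ[F] Fi) →
        twistNorm γ = I.pChar ^ I.fDeg)
    (hcover : ∀ (σ : Field.absoluteGaloisGroup (w.adicCompletion F)), IsAbsArithFrob σ → ∀ γ : Fi ≃ₐ[F] Fi,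
        ((AlgEquiv.restrictScalars F (Field.absoluteGaloisGroup.toAlgEquiv (w.adicCompletion F) σ) :
            AlgebraicClosure (w.adicCompletion F) ≃ₐ[F] AlgebraicClosure (w.adicCompletion F)) :
            AlgebraicClosure (w.adicCompletion F) →ₐ[F] AlgebraicClosure (w.adicCompletion F)).comp e = e.comp (γ : Fi →ₐ[F] Fi) →
        ∀ y : AlgPoints (S.M.obj Kc) (AlgebraicClosure (w.adicCompletion F)),
          FrobCover₀ 𝓜 w I.univ I.act I.dual I.pol I.lvl I.pChar I.fDeg (twistIdeal γ) (twistNorm γ)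
            (red₀Of S Kc 𝓜 w h𝓨 e (σ • y)) (red₀Of S Kc 𝓜 w h𝓨 e y))
    (hroof₀ : Quot₀RoofLaw I 𝔡 quotΩ 𝔯.spec.sp frobIdeal) :
    FrobReading₀ S Kc 𝓜 w h𝓨 e I.univ I.act I.dual I.pol I.lvl I.pChar I.fDeg (LineOf I) (SubOf I 𝔡) (kerFOf I 𝔡) quotΩ 𝔯.spec.sp twistIdeal twistNorm :=
  { frobIdeal := frobIdeal
    frobIdeal_spec := hfrobIdeal
    twistNorm_eq := htwistNorm
    quot₀_roof := hroof₀
    frob₀_cover := hcover }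

end Letters

end Summit.HodgeConjecture.HodgeConjecture.Cruxes.HLiu418.F0P6aDatumOfInputs

end
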